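import Summits.HubbardSuperconductivity.HubbardLadder.ClusterCutBlocks
import HarnessLib

/-!
# Cluster pair-cuts: the integer pair list of cut adv33_it4_s6 (`cut_oct12_adv33oct12it4.json` 079d544868894923, σ_road = −109671/500000 = the file's certified σ rounded down to 10⁻⁶)

HONEST FRAMING: ladder R1–R4 with certified numbers; no claim on H/H₀.  Cell pub-hubbard, lane r2-eng-1 (g14; g13 generators `adv06cert-g13/gen/`).  Kernel-side data of the cut
(`DEN = 10⁶`): the integer pair list `adv33it4P` (one orientation `(i, j, DEN·a_o)` per pair of orbit `o`, sites in the order of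
`Oct12Representation`) and `pairsOK 12 adv33it4P` (kernel).  The per-piece kernel certificates `ClusterCutOct12Adv33It4FrameNN` are stated for
`pairOp adv33it4P`; the identity with the cut's symmetric weight table (`= 2 • pairOp adv33it4P`) belongs with the row assembly.  All statements [folklore].
-/

namespace Summit.HubbardSuperconductivity.HubbardLadder.ClusterCut

open Matrix Literature.MathematicalPhysics.QuantumLattice

/-- The integer pair list of cut adv33_it4_s6: one orientation `(i, j, DEN·a_o)` per pair of orbit `o` (`DEN = 10⁶`; 66 pairs). -/
def adv33it4P : NatPairList :=
  [(0, 1, -977), (0, 2, 11871), (0, 3, 47453), (0, 4, 2175), (0, 5, -3003), (0, 6, -3003),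
   (0, 7, 8933), (0, 8, -6896), (0, 9, -1965), (0, 10, -3327), (0, 11, 146), (1, 2, -3003),
   (1, 3, 2175), (1, 4, 47453), (1, 5, 11871), (1, 6, -1965), (1, 7, -6896), (1, 8, 8933),
   (1, 9, -3003), (1, 10, 146), (1, 11, -3327), (2, 3, 47453), (2, 4, 8933), (2, 5, -3327),
   (2, 6, -977), (2, 7, 2175), (2, 8, -6896), (2, 9, 146), (2, 10, -3003), (2, 11, -1965),
   (3, 4, 92517), (3, 5, 8933), (3, 6, 2175), (3, 7, 92517), (3, 8, 4553), (3, 9, -6896),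
   (3, 10, 8933), (3, 11, -6896), (4, 5, 47453), (4, 6, -6896), (4, 7, 4553), (4, 8, 92517),
   (4, 9, 2175), (4, 10, -6896), (4, 11, 8933), (5, 6, 146), (5, 7, -6896), (5, 8, 2175),
   (5, 9, -977), (5, 10, -1965), (5, 11, -3003), (6, 7, 47453), (6, 8, 8933), (6, 9, -3327),
   (6, 10, 11871), (6, 11, -3003), (7, 8, 92517), (7, 9, 8933), (7, 10, 47453), (7, 11, 2175),
   (8, 9, 47453), (8, 10, 2175), (8, 11, 47453), (9, 10, -3003), (9, 11, 11871), (10, 11, -977)]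

/-- Kernel: in every pair of `adv33it4P` the sites are `< 12` and distinct. -/
theorem adv33it4P_ok : pairsOK 12 adv33it4P = true := by decide

end Summit.HubbardSuperconductivity.HubbardLadder.ClusterCut
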